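/-
Copyright (c) 2026 the pub-hodgecm-mathlib formalisation cell (harness21).  Prover seat hodgecm-mathlib-K2E4-p10 (g4), Track B ∕ K2-LIT, h413 =
`stmt-HodgeConjecture-24833`, line `K2_E1_TraceFormulaBeta`, campaign «EIS-RANK-ONE» rung R6g (brick (R6g-c), the `hcont` input of ★ (R6g-b) `K2E1MaassSelbergDiagonalCMThree`):
the truncated Eisenstein series `Λ^T E(φ, z)(g)` of `U(2,1)` over a CM field is CONTINUOUS IN THE SPECTRAL PARAMETER `z` at every fixed `g`.
-/
import Summits.HodgeConjecture.HodgeConjecture.Theorems.K2E1TruncatedEisensteinBoundedCMThree      -- ★ p857707: CM binders; imports ★ R6b Explicit (`subsingleton_setOf_lt_borelHeight_out_mul`, `siegel_three`), ★ R4a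
import Literature.NumberTheory.Automorphic.UnitaryGroupHeisenbergFundamentalDomain                   -- ★ Tate's `heisFundamentalDomain`: `existsUnique_smul_mem_…`, `exists_isCompact_…_subset`
import HarnessLib

/-!
# K2·E1 — `K2E1TruncatedEisensteinContinuousCMThree`: `z ↦ Λ^T E(φ, z)(g)` IS CONTINUOUS ON `{Re z > 2}` AT EVERY `g ∈ U(J₃)(𝔸_{L⁺})`
# (campaign «EIS-RANK-ONE», rung R6g, brick (R6g-c): the pointwise-continuity input `hcont` of the dominated-convergence step ★ (R6g-b), DISCHARGED at the CM pair)

Track B ∕ K2-LIT, crux h413 = `stmt-HodgeConjecture-24833`, route of record `HCCMUnconditional`; cell `hodgecm-mathlib`, squad K2, ENGINE E1.  Prover seat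
`hodgecm-mathlib-K2E4-p10` (g4); continuation of the STANDING ORDERS §F g3-v2 of the dealer K2E1-plan (g3) («EIS-R6g» (a)(b)), REPORT-FIRST 2026-09-04T06:27Z.  THEOREMS ONLY (no `def`,
no `instance`, no notation, no named-fact hypothesis, no `sorry`); lane `--supports stmt-HodgeConjecture-24833 --as helper` (count-neutral).  Closes no socket.

THE MATHEMATICS [Arthur1980TraceFormulaII, §1 and §4; MoeglinWaldspurger1995, I.2.13, II.1.5, IV.2.3; Garrett2018, §2.10].  `Λ^T ψ(g) = ψ(g) − Σ_{δ ∈ B(F)∖G(F)} (𝟙_{H>T}·ψ_B)(δ g)` and in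
`F`-rank one with `T ≥ 1` AT MOST ONE coset `δ` is high (★ R6b `subsingleton_setOf_lt_borelHeight_out_mul`): the δ-sum is a finite sum over ONE finite set `s_g` INDEPENDENT OF `ψ`
(§2 `continuousWithinAt_truncation_apply`), so for a family `Φ_p` the continuity of `p ↦ Λ^T Φ_p(g)` reduces to that of `p ↦ Φ_p(g)` and of the constant terms `p ↦ (Φ_p)_B(x)` at the
(finitely many) high points `x = δ g`.  The constant term `(Φ_p)_B(x) = ν(𝓕)⁻¹ ∫_𝓕 Φ_p(u x) dν(u)` is a parametric Bochner integral over the FINITE measure `ν|_𝓕`: dominated convergence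
(§1 `continuousWithinAt_borelConstantTerm_of_bound`) under a uniform bound on `u ↦ Φ_p(u x)`, which for left-`G(F)`-invariant `Φ_p` jointly continuous in `(p, y)` comes from the
COCOMPACTNESS of `N(F)` in `N(𝔸)` (§1 `exists_forall_norm_unipotent_mul_le`: `Φ_p(u x) = Φ_p((γu) x)` with `γu` in a compact `C`, ★ Tate's Heisenberg fundamental domain
`existsUnique_smul_mem_heisFundamentalDomain` ⊆ compact ★ `exists_isCompact_heisFundamentalDomain_subset` at `N = 3`).  §3 at the CM pair `(L⁺, L, conj)` with `Φ_z = E(φ, z)`, `φ`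
continuous, bounded, left-`B(L⁺)`-invariant: joint continuity ★ R4a `continuous_eisensteinSeriesU_flatSectionU_uncurry_cm_three`, `G(F)`-invariance ★
`eisensteinSeriesU_flatSectionU_arithmeticSubgroup_mul`, `hSiegel` ★ `siegel_three` ⟹ **`continuousOn_truncation_eisensteinSeriesU_flatSectionU_apply_cm_three`**: `z ↦ Λ^T E(φ,z)(g)` is
continuous on `{Re z > 2}` for every `g` (any Haar `ν`, any `𝓕` of finite measure), and the sub-tube corollary in the exact shape of ★ (R6g-b)'s `hcont`.  No named input.
HONEST LABEL: HC_CM is proved only modulo the 7 printed citations (2 remaining named inputs: hLiu418 = `stmt-HodgeConjecture-24832`, h413 = `stmt-HodgeConjecture-24833`) until rung 0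
closes; this file asserts no named fact and closes no socket.
References: [Arthur1980TraceFormulaII] §1, §4 · [MoeglinWaldspurger1995] I.2.13, II.1.5, IV.2.3 · [Garrett2018] §2.10 · [Rogawski1990] §2.1.
-/

set_option autoImplicit false
-- the mandated namespace repeats the single-problem summit's segment (`HodgeConjecture.HodgeConjecture`)
set_option linter.dupNamespace false

noncomputable section

open MeasureTheory Measure NumberField IsDedekindDomain Set Filter Topology MulAction
open scoped ENNReal NNReal Pointwise
open Literature.NumberTheory.Automorphic Literature.NumberTheory.Automorphic.UnitaryGroup AdelicGroupData
open Summit.HodgeConjecture.HodgeConjecture.Cruxes.H413.K2E1BorelEisensteinU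
open Summit.HodgeConjecture.HodgeConjecture.Cruxes.H413.K2E1TruncatedEisensteinExplicit
open Summit.HodgeConjecture.HodgeConjecture.Cruxes.H413.K2E1BorelEisensteinRegularCMThree
open Summit.HodgeConjecture.HodgeConjecture.Cruxes.H413.K2E1TruncatedEisensteinBoundedCMThree

namespace Summit.HodgeConjecture.HodgeConjecture.Cruxes.H413.K2E1TruncatedEisensteinContinuousCMThree

variable {F E : Type} [Field F] [NumberField F] [Field E] [NumberField E] [Algebra F E] {c : E ≃ₐ[F] E} {N : ℕ} [NeZero N]
variable {P : Type*} [TopologicalSpace P]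

/-! ## §1 The constant term of a family: dominated convergence over `ν|_𝓕`, and the uniform bound from cocompactness of `N(F)` -/

section ConstantTerm

variable [MeasurableSpace (adelicUnipotent F E c N)]

omit [NeZero N] in
/-- **`p ↦ (Φ_p)_B(x)` IS CONTINUOUS (within `S`, at `p₀`)** when `ν(𝓕) < ∞`, the `u ↦ Φ_p(u x)` are a.e.-strongly measurable on `ν|_𝓕` and UNIFORMLY bounded on `N(𝔸)` for `p` near
`p₀`, and `p ↦ Φ_p(u x)` is continuous within `S` at `p₀` for every `u` — Mathlib `continuousWithinAt_of_dominated` over the finite measure `ν|_𝓕` with a constant bound, times the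
scalar `ν(𝓕)⁻¹`. [cite: MoeglinWaldspurger1995, II.1.5 and IV.2.3] [cite: Arthur1980TraceFormulaII, §4] -/
theorem continuousWithinAt_borelConstantTerm_of_bound [FirstCountableTopology P] (ν : Measure (adelicUnipotent F E c N)) {𝓕 : Set (adelicUnipotent F E c N)}
    (h𝓕top : ν 𝓕 ≠ ∞) {Φ : P → (quasiSplit F E c N).Adelic → ℂ} {S : Set P} {p₀ : P} (x : (quasiSplit F E c N).Adelic)
    (hm : ∀ᶠ p in 𝓝[S] p₀, AEStronglyMeasurable (fun u : adelicUnipotent F E c N => Φ p ((u : (quasiSplit F E c N).Adelic) * x)) (ν.restrict 𝓕))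
    {C : ℝ} (hbd : ∀ᶠ p in 𝓝[S] p₀, ∀ u : adelicUnipotent F E c N, ‖Φ p ((u : (quasiSplit F E c N).Adelic) * x)‖ ≤ C)
    (hc : ∀ u : adelicUnipotent F E c N, ContinuousWithinAt (fun p => Φ p ((u : (quasiSplit F E c N).Adelic) * x)) S p₀) :
    ContinuousWithinAt (fun p => borelConstantTerm ν 𝓕 (Φ p) x) S p₀ := by
  haveI : IsFiniteMeasure (ν.restrict 𝓕) := isFiniteMeasure_restrict.2 h𝓕top
  have hint : ContinuousWithinAt (fun p => ∫ u in 𝓕, Φ p ((u : (quasiSplit F E c N).Adelic) * x) ∂ν) S p₀ :=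
    continuousWithinAt_of_dominated (bound := fun _ => C) hm (by filter_upwards [hbd] with p hp; exact ae_of_all _ fun u => hp u) (integrable_const C)
      (ae_of_all _ fun u => hc u)
  exact hint.const_smul ((ν 𝓕).toReal⁻¹ : ℝ)

end ConstantTerm

section Cocompact

omit [NeZero N] in
/-- **THE UNIFORM BOUND FROM COCOMPACTNESS OF `N(F)` IN `N(𝔸)`**: if a compact `C ⊆ N(𝔸)` meets every left `N(F)`-orbit, `Z` is a compact set of parameters, `(p, y) ↦ Φ_p(y)` is continuous
on `Z × G(𝔸)` and every `Φ_p` (`p ∈ Z`) is left-`G(F)`-invariant, then for each `x` ONE constant bounds `‖Φ_p(u x)‖` for all `p ∈ Z`, all `u ∈ N(𝔸)` (`Φ_p(u x) = Φ_p((γu) x)`, `γu ∈ C`,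
continuity on the compact `Z ×ˢ C`). [cite: MoeglinWaldspurger1995, I.2.1 and II.1.5] [cite: Rogawski1990, §2.1] -/
theorem exists_forall_norm_unipotent_mul_le {C : Set (adelicUnipotent F E c N)} (hC : IsCompact C)
    (hcov : ∀ u : adelicUnipotent F E c N, ∃ γ : rationalUnipotent F E c N, γ • u ∈ C)
    {Z : Set P} (hZ : IsCompact Z) {Φ : P → (quasiSplit F E c N).Adelic → ℂ}
    (hΦc : ContinuousOn (fun q : P × (quasiSplit F E c N).Adelic => Φ q.1 q.2) (Z ×ˢ univ))
    (hΦ : ∀ p ∈ Z, ∀ (γ : (quasiSplit F E c N).arithmeticSubgroup) (y : (quasiSplit F E c N).Adelic), Φ p ((γ : (quasiSplit F E c N).Adelic) * y) = Φ p y)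
    (x : (quasiSplit F E c N).Adelic) :
    ∃ C₀ : ℝ, ∀ p ∈ Z, ∀ u : adelicUnipotent F E c N, ‖Φ p ((u : (quasiSplit F E c N).Adelic) * x)‖ ≤ C₀ := by
  -- `(p, k) ↦ Φ_p(k x)` is continuous on the compact `Z ×ˢ C`
  have hcont : ContinuousOn (fun q : P × adelicUnipotent F E c N => Φ q.1 ((q.2 : (quasiSplit F E c N).Adelic) * x)) (Z ×ˢ C) := by
    have hι : Continuous fun q : P × adelicUnipotent F E c N => (q.1, (q.2 : (quasiSplit F E c N).Adelic) * x) :=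
      continuous_fst.prodMk ((continuous_subtype_val.comp continuous_snd).mul continuous_const)
    exact hΦc.comp hι.continuousOn fun q hq => mk_mem_prod hq.1 (mem_univ _)
  obtain ⟨C₀, hC₀⟩ := (hZ.prod hC).exists_bound_of_continuousOn hcont
  refine ⟨C₀, fun p hp u => ?_⟩
  obtain ⟨γ, hγ⟩ := hcov u
  -- `Φ_p(u x) = Φ_p(γ u x)`, `γ ∈ N(F) ≤ G(F)`
  have hγG : (((γ : rationalUnipotent F E c N) : adelicUnipotent F E c N) : (quasiSplit F E c N).Adelic) ∈ (quasiSplit F E c N).arithmeticSubgroup := γ.2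
  have heq : Φ p ((u : (quasiSplit F E c N).Adelic) * x) = Φ p (((γ • u : adelicUnipotent F E c N) : (quasiSplit F E c N).Adelic) * x) := by
    rw [Subgroup.smul_def, smul_eq_mul, Subgroup.coe_mul, mul_assoc]
    exact (hΦ p hp ⟨_, hγG⟩ _).symm
  rw [heq]
  exact hC₀ (p, γ • u) (mk_mem_prod hp hγ)

/-- **`U(J₃)`: Tate's Heisenberg fundamental domain gives the compact cover** — there is a compact `C ⊆ N(𝔸_F)` meeting every left `N(F)`-orbit (★ `heisFundamentalDomain` ⊆ compact ★
`exists_isCompact_heisFundamentalDomain_subset`, and ★ `existsUnique_smul_mem_heisFundamentalDomain`). [cite: Rogawski1990, §2.1] -/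
theorem exists_isCompact_rationalUnipotent_smul_mem_three {F E : Type} [Field F] [NumberField F] [Field E] [NumberField E] [Algebra F E] {c : E ≃ₐ[F] E} (hc : c * c = 1) :
    ∃ C : Set (adelicUnipotent F E c 3), IsCompact C ∧ ∀ u : adelicUnipotent F E c 3, ∃ γ : rationalUnipotent F E c 3, γ • u ∈ C := by
  obtain ⟨C, hC, hsub⟩ := exists_isCompact_heisFundamentalDomain_subset (F := F) (E := E) (c := c) hc
  exact ⟨C, hC, fun u => (existsUnique_smul_mem_heisFundamentalDomain (F := F) hc u).exists.imp fun γ hγ => hsub hγ⟩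

end Cocompact

/-! ## §2 The truncation of a family at a fixed point: ONE finite δ-set for all parameters (`F`-rank one, `T ≥ 1`) -/

section Truncation

variable [MeasurableSpace (adelicUnipotent F E c N)]

/-- **`p ↦ Λ^T Φ_p(g)` IS CONTINUOUS (within `S`, at `p₀`)** as soon as `p ↦ Φ_p(g)` is and `p ↦ (Φ_p)_B(x)` is at every HIGH point `x` (`H(x) > T`): under `hSiegel` with `T ≥ 1` the δ-sum
`Σ_δ (𝟙_{H>T}(Φ_p)_B)(δ g)` runs over ONE finite (indeed subsingleton) set of cosets independent of `p` (★ R6b `subsingleton_setOf_lt_borelHeight_out_mul`; `finsum_eq_sum_of_support_subset`),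
on which the cut-off is `1`. [cite: Garrett2018, §2.10] [cite: Arthur1980TraceFormulaII, §1] -/
theorem continuousWithinAt_truncation_apply
    (hSiegel : ∀ γ : (quasiSplit F E c N).arithmeticSubgroup, γ ∉ arithmeticBorel F E c N →
      ∀ g : (quasiSplit F E c N).Adelic, borelHeight ((γ : (quasiSplit F E c N).Adelic) * g) * borelHeight g ≤ 1)
    (ν : Measure (adelicUnipotent F E c N)) (𝓕 : Set (adelicUnipotent F E c N)) {T : ℝ≥0} (hT : 1 ≤ T)
    {Φ : P → (quasiSplit F E c N).Adelic → ℂ} {S : Set P} {p₀ : P} (g : (quasiSplit F E c N).Adelic)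
    (hΦg : ContinuousWithinAt (fun p => Φ p g) S p₀)
    (hCT : ∀ x : (quasiSplit F E c N).Adelic, T < borelHeight x → ContinuousWithinAt (fun p => borelConstantTerm ν 𝓕 (Φ p) x) S p₀) :
    ContinuousWithinAt (fun p => truncation ν 𝓕 T (Φ p) g) S p₀ := by
  classical
  -- the one finite set of high cosets at `g`
  have hfin := (subsingleton_setOf_lt_borelHeight_out_mul hSiegel hT g).finite
  set s := hfin.toFinset with hs
  have hsum : ∀ p, pseudoEisenstein (constantTermTail ν 𝓕 T (Φ p)) g =
      ∑ q ∈ s, constantTermTail ν 𝓕 T (Φ p) (((q.out : (quasiSplit F E c N).arithmeticSubgroup) : (quasiSplit F E c N).Adelic) * g) := fun p => by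
    rw [pseudoEisenstein_def]
    refine finsum_eq_sum_of_support_subset _ fun q hq => ?_
    rw [Function.mem_support] at hq
    rw [Finset.mem_coe, hs, Set.Finite.mem_toFinset, Set.mem_setOf_eq]
    by_contra h
    exact hq (constantTermTail_of_not_lt _ h)
  have heq : (fun p => truncation ν 𝓕 T (Φ p) g) =
      fun p => Φ p g - ∑ q ∈ s, constantTermTail ν 𝓕 T (Φ p) (((q.out : (quasiSplit F E c N).arithmeticSubgroup) : (quasiSplit F E c N).Adelic) * g) :=
    funext fun p => by rw [truncation_def, hsum p]
  rw [heq]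
  refine hΦg.sub ?_
  change Tendsto (fun p => ∑ q ∈ s, constantTermTail ν 𝓕 T (Φ p) (((q.out : (quasiSplit F E c N).arithmeticSubgroup) : (quasiSplit F E c N).Adelic) * g)) (𝓝[S] p₀)
    (𝓝 (∑ q ∈ s, constantTermTail ν 𝓕 T (Φ p₀) (((q.out : (quasiSplit F E c N).arithmeticSubgroup) : (quasiSplit F E c N).Adelic) * g)))
  refine tendsto_finsetSum s fun q hq => ?_
  have hq' : T < borelHeight (((q.out : (quasiSplit F E c N).arithmeticSubgroup) : (quasiSplit F E c N).Adelic) * g) := by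
    rw [hs, Set.Finite.mem_toFinset, Set.mem_setOf_eq] at hq
    exact hq
  have hterm : ∀ p, constantTermTail ν 𝓕 T (Φ p) (((q.out : (quasiSplit F E c N).arithmeticSubgroup) : (quasiSplit F E c N).Adelic) * g) =
      borelConstantTerm ν 𝓕 (Φ p) (((q.out : (quasiSplit F E c N).arithmeticSubgroup) : (quasiSplit F E c N).Adelic) * g) := fun p => constantTermTail_of_lt _ hq'
  simp only [hterm]
  exact hCT _ hq'

end Truncation

/-! ## §3 The CM pair `(L⁺, L, conj)`, `U(J₃)`: `z ↦ Λ^T E(φ, z)(g)` is continuous on `{Re z > 2}` -/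

section CM

variable (L : Type) [Field L] [NumberField L] [IsCMField L]
variable [MeasurableSpace (adelicUnipotent (↥(maximalRealSubfield L)) L (IsCMField.complexConj L) 3)]
  [BorelSpace (adelicUnipotent (↥(maximalRealSubfield L)) L (IsCMField.complexConj L) 3)]

/-- **`z ↦ E(φ, z)_B(x)` IS CONTINUOUS ON `{Re z > 2}`** (typed on the half-plane subtype) at every `x`, for `φ` continuous, bounded, left-`B(L⁺)`-invariant, any Haar `ν` and any `𝓕` with
`ν(𝓕) < ∞`: §1 dominated convergence, the uniform bound by cocompactness (§1) on a compact neighbourhood of the parameter, joint continuity ★ R4a. [cite: MoeglinWaldspurger1995, II.1.5 and II.1.7] -/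
theorem continuous_borelConstantTerm_eisensteinSeriesU_flatSectionU_cm_three
    (ν : Measure (adelicUnipotent (↥(maximalRealSubfield L)) L (IsCMField.complexConj L) 3)) [ν.IsHaarMeasure]
    {𝓕 : Set (adelicUnipotent (↥(maximalRealSubfield L)) L (IsCMField.complexConj L) 3)} (h𝓕top : ν 𝓕 ≠ ∞)
    {φ : (quasiSplit (↥(maximalRealSubfield L)) L (IsCMField.complexConj L) 3).Adelic → ℂ} (hφc : Continuous φ) {M : ℝ} (hφM : ∀ x, ‖φ x‖ ≤ M)
    (hφB : ∀ b ∈ borelU ((IsCMField.complexConj L : L ≃ₐ[↥(maximalRealSubfield L)] L) : L →+* L) ((StdForm.antidiagonal 3).over L),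
      ∀ x : (quasiSplit (↥(maximalRealSubfield L)) L (IsCMField.complexConj L) 3).Adelic,
        φ ((quasiSplit (↥(maximalRealSubfield L)) L (IsCMField.complexConj L) 3).toAdelic b * x) = φ x)
    (x : (quasiSplit (↥(maximalRealSubfield L)) L (IsCMField.complexConj L) 3).Adelic) :
    Continuous fun w : {z : ℂ // 2 < z.re} => borelConstantTerm ν 𝓕 (eisensteinSeriesU (flatSectionU φ (w : ℂ))) x := by
  have hjoint := continuous_eisensteinSeriesU_flatSectionU_uncurry_cm_three L hφc hφM
  obtain ⟨C, hC, hcov⟩ := exists_isCompact_rationalUnipotent_smul_mem_three (F := ↥(maximalRealSubfield L)) (E := L) (c := IsCMField.complexConj L)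
    (AlgEquiv.ext fun x => IsCMField.complexConj_apply_apply L x)
  refine continuous_iff_continuousAt.2 fun w₀ => ?_
  -- a compact neighbourhood `Z` of `w₀` in the half-plane
  set r : ℝ := ((w₀ : ℂ).re - 2) / 2 with hr
  have hr0 : 0 < r := by rw [hr]; linarith [w₀.2]
  have hball : ∀ z ∈ Metric.closedBall (w₀ : ℂ) r, 2 < z.re := by
    intro z hz
    have hdist : dist z (w₀ : ℂ) ≤ r := Metric.mem_closedBall.1 hz
    have h1 := Complex.abs_re_le_norm (z - (w₀ : ℂ))
    rw [Complex.sub_re, ← Complex.dist_eq] at h1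
    have h2 := (abs_le.1 (h1.trans hdist)).1
    rw [hr] at h2
    linarith [w₀.2]
  have hZ : IsCompact ((Subtype.val : {z : ℂ // 2 < z.re} → ℂ) ⁻¹' Metric.closedBall (w₀ : ℂ) r) := by
    have hsub : Metric.closedBall (w₀ : ℂ) r ∩ {z : ℂ | 2 < z.re} = Metric.closedBall (w₀ : ℂ) r := inter_eq_left.2 fun z hz => hball z hz
    rw [Subtype.isCompact_iff, image_preimage_eq_inter_range, Subtype.range_coe_subtype, hsub]
    exact isCompact_closedBall _ _
  have hZn : ((Subtype.val : {z : ℂ // 2 < z.re} → ℂ) ⁻¹' Metric.closedBall (w₀ : ℂ) r) ∈ 𝓝 w₀ :=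
    continuous_subtype_val.continuousAt.preimage_mem_nhds (Metric.closedBall_mem_nhds _ hr0)
  obtain ⟨C₀, hC₀⟩ := exists_forall_norm_unipotent_mul_le hC hcov hZ
    (Φ := fun (w : {z : ℂ // 2 < z.re}) y => eisensteinSeriesU (flatSectionU φ (w : ℂ)) y) hjoint.continuousOn
    (fun w _ γ y => eisensteinSeriesU_flatSectionU_arithmeticSubgroup_mul hφB (w : ℂ) γ y) x
  -- dominated convergence over `ν|_𝓕`
  have hslice : ∀ u : adelicUnipotent (↥(maximalRealSubfield L)) L (IsCMField.complexConj L) 3,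
      Continuous fun w : {z : ℂ // 2 < z.re} => eisensteinSeriesU (flatSectionU φ (w : ℂ)) ((u : (quasiSplit (↥(maximalRealSubfield L)) L (IsCMField.complexConj L) 3).Adelic) * x) := by
    intro u
    have h1 : Continuous fun w : {z : ℂ // 2 < z.re} =>
        ((w, ((u : (quasiSplit (↥(maximalRealSubfield L)) L (IsCMField.complexConj L) 3).Adelic) * x)) :
          {z : ℂ // 2 < z.re} × (quasiSplit (↥(maximalRealSubfield L)) L (IsCMField.complexConj L) 3).Adelic) :=
      continuous_id.prodMk continuous_const
    have h2 := hjoint.comp h1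
    rw [Function.comp_def] at h2
    exact h2
  have hmulx : Continuous fun u : adelicUnipotent (↥(maximalRealSubfield L)) L (IsCMField.complexConj L) 3 =>
      ((u : (quasiSplit (↥(maximalRealSubfield L)) L (IsCMField.complexConj L) 3).Adelic) * x) := continuous_subtype_val.mul continuous_const
  have hmeas : ∀ w : {z : ℂ // 2 < z.re}, AEStronglyMeasurable
      (fun u : adelicUnipotent (↥(maximalRealSubfield L)) L (IsCMField.complexConj L) 3 =>
        eisensteinSeriesU (flatSectionU φ (w : ℂ)) ((u : (quasiSplit (↥(maximalRealSubfield L)) L (IsCMField.complexConj L) 3).Adelic) * x)) (ν.restrict 𝓕) := by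
    intro w
    have h3 := (continuous_eisensteinSeriesU_flatSectionU_cm_three L w.2 hφc hφM).comp hmulx
    rw [Function.comp_def] at h3
    exact h3.aestronglyMeasurable
  exact (continuousWithinAt_univ _ _).1
    (continuousWithinAt_borelConstantTerm_of_bound (S := (univ : Set {z : ℂ // 2 < z.re})) ν h𝓕top x (Eventually.of_forall hmeas) (C := C₀)
      (mem_nhdsWithin_of_mem_nhds (Filter.mem_of_superset hZn fun w hw => hC₀ w hw)) fun u => (hslice u).continuousAt.continuousWithinAt)

/-- **`z ↦ Λ^T E(φ, z)(g)` IS CONTINUOUS ON `{Re z > 2}`** (typed on the half-plane subtype) at every `g`: §2 with `hSiegel` ★ `siegel_three`, the joint continuity ★ R4a for `z ↦ E(φ,z)(g)`, and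
the constant terms by `continuous_borelConstantTerm_eisensteinSeriesU_flatSectionU_cm_three`.  `φ` continuous, bounded, left-`B(L⁺)`-invariant; any Haar `ν`, any `𝓕` with `ν(𝓕) < ∞`, `T ≥ 1`.
[cite: Arthur1980TraceFormulaII, §4] [cite: MoeglinWaldspurger1995, IV.2.3] -/
theorem continuous_truncation_eisensteinSeriesU_flatSectionU_apply_cm_three
    (ν : Measure (adelicUnipotent (↥(maximalRealSubfield L)) L (IsCMField.complexConj L) 3)) [ν.IsHaarMeasure]
    {𝓕 : Set (adelicUnipotent (↥(maximalRealSubfield L)) L (IsCMField.complexConj L) 3)} (h𝓕top : ν 𝓕 ≠ ∞) {T : ℝ≥0} (hT : 1 ≤ T)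
    {φ : (quasiSplit (↥(maximalRealSubfield L)) L (IsCMField.complexConj L) 3).Adelic → ℂ} (hφc : Continuous φ) {M : ℝ} (hφM : ∀ x, ‖φ x‖ ≤ M)
    (hφB : ∀ b ∈ borelU ((IsCMField.complexConj L : L ≃ₐ[↥(maximalRealSubfield L)] L) : L →+* L) ((StdForm.antidiagonal 3).over L),
      ∀ x : (quasiSplit (↥(maximalRealSubfield L)) L (IsCMField.complexConj L) 3).Adelic,
        φ ((quasiSplit (↥(maximalRealSubfield L)) L (IsCMField.complexConj L) 3).toAdelic b * x) = φ x)
    (g : (quasiSplit (↥(maximalRealSubfield L)) L (IsCMField.complexConj L) 3).Adelic) :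
    Continuous fun w : {z : ℂ // 2 < z.re} => truncation ν 𝓕 T (eisensteinSeriesU (flatSectionU φ (w : ℂ))) g := by
  have hjoint := continuous_eisensteinSeriesU_flatSectionU_uncurry_cm_three L hφc hφM
  have hg : Continuous fun w : {z : ℂ // 2 < z.re} => eisensteinSeriesU (flatSectionU φ (w : ℂ)) g := by
    have h1 : Continuous fun w : {z : ℂ // 2 < z.re} => ((w, g) : {z : ℂ // 2 < z.re} × (quasiSplit (↥(maximalRealSubfield L)) L (IsCMField.complexConj L) 3).Adelic) :=
      continuous_id.prodMk continuous_const
    have h2 := hjoint.comp h1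
    rw [Function.comp_def] at h2
    exact h2
  refine continuous_iff_continuousAt.2 fun w₀ => (continuousWithinAt_univ _ _).1 ?_
  exact continuousWithinAt_truncation_apply (Φ := fun (w : {z : ℂ // 2 < z.re}) y => eisensteinSeriesU (flatSectionU φ (w : ℂ)) y) siegel_three ν 𝓕 hT g
    hg.continuousAt.continuousWithinAt fun x _ => (continuous_borelConstantTerm_eisensteinSeriesU_flatSectionU_cm_three L ν h𝓕top hφc hφM hφB x).continuousAt.continuousWithinAt

/-- **`z ↦ Λ^T E(φ, z)(g)` IS CONTINUOUS ON THE OPEN HALF-PLANE `{z | Re z > 2}`** (plain `ContinuousOn` on `ℂ`), every `g`. [cite: Arthur1980TraceFormulaII, §4] [cite: MoeglinWaldspurger1995, IV.2.3] -/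
theorem continuousOn_truncation_eisensteinSeriesU_flatSectionU_apply_cm_three
    (ν : Measure (adelicUnipotent (↥(maximalRealSubfield L)) L (IsCMField.complexConj L) 3)) [ν.IsHaarMeasure]
    {𝓕 : Set (adelicUnipotent (↥(maximalRealSubfield L)) L (IsCMField.complexConj L) 3)} (h𝓕top : ν 𝓕 ≠ ∞) {T : ℝ≥0} (hT : 1 ≤ T)
    {φ : (quasiSplit (↥(maximalRealSubfield L)) L (IsCMField.complexConj L) 3).Adelic → ℂ} (hφc : Continuous φ) {M : ℝ} (hφM : ∀ x, ‖φ x‖ ≤ M)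
    (hφB : ∀ b ∈ borelU ((IsCMField.complexConj L : L ≃ₐ[↥(maximalRealSubfield L)] L) : L →+* L) ((StdForm.antidiagonal 3).over L),
      ∀ x : (quasiSplit (↥(maximalRealSubfield L)) L (IsCMField.complexConj L) 3).Adelic,
        φ ((quasiSplit (↥(maximalRealSubfield L)) L (IsCMField.complexConj L) 3).toAdelic b * x) = φ x)
    (g : (quasiSplit (↥(maximalRealSubfield L)) L (IsCMField.complexConj L) 3).Adelic) :
    ContinuousOn (fun z : ℂ => truncation ν 𝓕 T (eisensteinSeriesU (flatSectionU φ z)) g) {z : ℂ | 2 < z.re} :=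
  continuousOn_iff_continuous_restrict.2 (continuous_truncation_eisensteinSeriesU_flatSectionU_apply_cm_three L ν h𝓕top hT hφc hφM hφB g)

/-- **The `hcont` input of ★ (R6g-b) `maassSelberg_diagonal_flatSectionU_cm_three`, DISCHARGED**: for `Re z > 2`, `z′ ↦ Λ^T E(φ, z′)(g)` is continuous within the sub-tube
`{2 < Re z′ < Re z}` at `z′ = z`, every `g`. [cite: Arthur1980TraceFormulaII, §4] [cite: MoeglinWaldspurger1995, IV.2.3] -/
theorem continuousWithinAt_truncation_eisensteinSeriesU_flatSectionU_subtube_cm_three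
    (ν : Measure (adelicUnipotent (↥(maximalRealSubfield L)) L (IsCMField.complexConj L) 3)) [ν.IsHaarMeasure]
    {𝓕 : Set (adelicUnipotent (↥(maximalRealSubfield L)) L (IsCMField.complexConj L) 3)} (h𝓕top : ν 𝓕 ≠ ∞) {T : ℝ≥0} (hT : 1 ≤ T)
    {φ : (quasiSplit (↥(maximalRealSubfield L)) L (IsCMField.complexConj L) 3).Adelic → ℂ} (hφc : Continuous φ) {M : ℝ} (hφM : ∀ x, ‖φ x‖ ≤ M)
    (hφB : ∀ b ∈ borelU ((IsCMField.complexConj L : L ≃ₐ[↥(maximalRealSubfield L)] L) : L →+* L) ((StdForm.antidiagonal 3).over L),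
      ∀ x : (quasiSplit (↥(maximalRealSubfield L)) L (IsCMField.complexConj L) 3).Adelic,
        φ ((quasiSplit (↥(maximalRealSubfield L)) L (IsCMField.complexConj L) 3).toAdelic b * x) = φ x)
    {z : ℂ} (hz : 2 < z.re) (g : (quasiSplit (↥(maximalRealSubfield L)) L (IsCMField.complexConj L) 3).Adelic) :
    ContinuousWithinAt (fun z' : ℂ => truncation ν 𝓕 T (eisensteinSeriesU (flatSectionU φ z')) g) {z' : ℂ | 2 < z'.re ∧ z'.re < z.re} z :=
  ((continuousOn_truncation_eisensteinSeriesU_flatSectionU_apply_cm_three L ν h𝓕top hT hφc hφM hφB g).continuousAt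
    ((isOpen_lt continuous_const Complex.continuous_re).mem_nhds hz)).continuousWithinAt

end CM

end Summit.HodgeConjecture.HodgeConjecture.Cruxes.H413.K2E1TruncatedEisensteinContinuousCMThree

end
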